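import Summits.Schanuel.Schanuel.Theses.RoyCriterion
import Summits.Schanuel.Schanuel.Theses.DiophantineDichotomy
import Summits.Schanuel.Schanuel.Theorems.DiophantineDichotomyKhovanskiiReduction
import Summits.Schanuel.Schanuel.Theorems.RoyThesisTyped.Negative.RankStructure
import Summits.Schanuel.Schanuel.Theorems.RoyCriterionRoyThesisTypedPointwise
import Summits.Schanuel.Schanuel.Theorems.RoyCriterionSchanuelTwoLineSketch
import Literature.Barriers.Schanuel.LargeTranscendenceDegree

/-!
# Splits of crux `RoyThesisTyped` (stmt-Schanuel-0463): the available glue, and two certificates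

Crux `Summit.Schanuel.Schanuel.Theses.RoyCriterion.RoyThesisTyped = ∀ n, RoyCriterion n` (Roy 2001,
Conjecture 2 in every rank; kernel-equivalent to Schanuel's conjecture by `Roy2001_iff_holds`).
Companion of the strategy census `Cruxes/RoyThesisTyped/STRATEGY-CENSUS.md` (crux-strategist seat,
2026-08-17). Def-free, sorry-free, no named-fact hypotheses beyond registered route items.

* §0 `RoyThesisTyped.of_route` / `RoyThesisTyped.to_route` — a deciding theorem `C → Schanuel` of ANY
  route of the summit is a concluding composition `C → RoyThesisTyped` on this crux, and conversely:
  lines on this crux and routes on the summit are the same objects.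
* §1 THE AVAILABLE SPLIT GLUE (decomposition by attachment to route `DiophantineDichotomy`, the typed
  Laurent–Roy approximation race that Roy 2001 p.184 names as the model of Conjecture 2):
  `RoyThesisTyped.of_subs : ApproximationProperty → KhovanskiiApproxTypeEv → RoyThesisTyped`
  (hypotheses = the registered items stmt-Schanuel-6117 / stmt-Schanuel-14972 of that route; its
  reduction `KhovanskiiReduction` is the tree theorem `khovanskiiReduction_proof`). Usable verbatim as
  `--glue-by` of a `route edit --split RoyThesisTyped` whose children are those two signatures.
* §2 COSTUME CERTIFICATE for the split by rank: the glue
  `SchanuelTwo → (∀ l ≥ 2, SchanuelRank l → SchanuelRank (l+1)) → RoyThesisTyped` holds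
  (`RoyThesisTyped.of_schanuelTwo_of_rankStep`), but the rank step is EQUIVALENT to
  `SchanuelTwo → RoyThesisTyped` (`RoyThesisTyped.rankStep_iff_complement`, via the up-set theorem
  `RoyThesisTyped.schanuelRank_anti`): the second child is the bare complement of the first.
* §3 TOOTHLESSNESS CERTIFICATE for the split by Diophantine regime: the Technical Hypothesis of the
  large-transcendence-degree method (`Literature.Barriers.Schanuel.TechnicalHypothesis`,
  Nesterenko–Philippon LNM 1752 Ch. 14 Def. 2.6) HOLDS at the flagship tuple `(1, πi)`
  (`RoyThesisTyped.technicalHypothesis_one_piI`), so the "Diophantine-generic" half of the crux still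
  implies the algebraic independence of `e` and `π`
  (`RoyThesisTyped.expOnePi_of_crux_on_technicalHypothesis`).
* §4 The strengthening "conclusion `l + 1`" of the typed crux is false
  (`RoyThesisTyped.not_succ_conclusion`, from the tree's `royHypothesis_exp'` at `(1, e)`).
-/

set_option linter.dupNamespace false

noncomputable section

namespace Summit.Schanuel.Schanuel.Theorems

open Complex
open Literature.NumberTheory.Transcendental
open Summit.Schanuel.Schanuel.Theses.RoyCriterion (RoyThesisTyped SchanuelTwo)

/-! ## §0 Lines on this crux = routes on the summit -/

/-- **Every route of the summit is a line on this crux**: a deciding theorem `closes : C → Schanuel`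
gives the concluding composition `C → RoyThesisTyped` (through `Roy2001_iff_holds`). [cite: Roy2001, §5] -/
theorem RoyThesisTyped.of_route {C : Prop} (closes : C → _root_.Schanuel) (h : C) : RoyThesisTyped :=
  fun n => (Roy2001_iff_holds n).mpr (closes h n)

/-- **… and every line on this crux is a route of the summit.** [cite: Roy2001, §5] -/
theorem RoyThesisTyped.to_route {C : Prop} (line : C → RoyThesisTyped) (h : C) : _root_.Schanuel :=
  fun n => (Roy2001_iff_holds n).mp (line h n)

/-! ## §1 The available split glue: attachment to route `DiophantineDichotomy` -/

/-- **Split glue `RoyThesisTyped ⇐ ApproximationProperty ∧ KhovanskiiApproxTypeEv`.** Philippon's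
approximation property in transcendence degree `t` (GL326 Conj. 15.31 / AP2; item stmt-Schanuel-6117)
and the eventual simultaneous approximation type at free Khovanskii points (item stmt-Schanuel-14972)
imply Roy's Conjecture 2 in every rank, through route DiophantineDichotomy's deciding theorem `closes`
(whose third hypothesis `KhovanskiiReduction` is the tree theorem `khovanskiiReduction_proof`:
Ax 1971 + the Khovanskii dichotomy) and `Roy2001_iff_holds`. Typed form of Roy 2001 p.184: Conjecture 2
"is similar to the present criteria of algebraic independence [Laurent–Roy], [Philippon]; it
suggests, we hope, a reasonable approach toward Schanuel's conjecture".
[cite: Roy2001, §1 p.184] [cite: Waldschmidt2004, §4 (GL326 Conj. 15.31)] -/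
theorem RoyThesisTyped.of_subs
    (hAP : Summit.Schanuel.Schanuel.Theses.DiophantineDichotomy.ApproximationProperty)
    (hEv : Summit.Schanuel.Schanuel.Theses.DiophantineDichotomy.KhovanskiiApproxTypeEv) :
    RoyThesisTyped :=
  fun n => (Roy2001_iff_holds n).mpr
    (Summit.Schanuel.Schanuel.Theses.DiophantineDichotomy.closes hAP hEv khovanskiiReduction_proof n)

/-! ## §2 The split by rank is costume -/

/-- Ranks `0, 1` of Roy's criterion are tree theorems (`royCriterion_zero`; Hermite–Lindemann through
`Roy2001_iff_holds`). [cite: Roy2001, §1 p.184] -/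
theorem RoyThesisTyped.royCriterion_of_lt_two {n : ℕ} (hn : n < 2) : RoyCriterion n := by
  interval_cases n
  · exact royCriterion_zero
  · exact Literature.Transcend.royCriterion_one_of_facts Roy2001_iff_holds transcendental_exp_holds

/-- **Glue of the rank split** `SchanuelTwo → RankStep → RoyThesisTyped`, where
`RankStep = ∀ l ≥ 2, SchanuelRank l → SchanuelRank (l + 1)` (induction on the rank from `l = 2`).
[folklore] -/
theorem RoyThesisTyped.of_schanuelTwo_of_rankStep (h2 : SchanuelTwo)
    (hs : ∀ l : ℕ, 2 ≤ l → SchanuelRank l → SchanuelRank (l + 1)) : RoyThesisTyped := by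
  have hS : ∀ l, 2 ≤ l → SchanuelRank l := by
    intro l hl
    induction l, hl using Nat.le_induction with
    | base => exact schanuelTwo_iff_schanuelRank_two.mp h2
    | succ l hl ih => exact hs l hl ih
  intro n
  by_cases hn : 2 ≤ n
  · exact (Roy2001_iff_holds n).mpr (hS n hn)
  · exact RoyThesisTyped.royCriterion_of_lt_two (by omega)

/-- **COSTUME CERTIFICATE**: the rank step is EQUIVALENT to "`SchanuelTwo` → crux" (`←`: a hypothesis
`SchanuelRank l` with `l ≥ 2` contains `SchanuelRank 2` by the up-set theorem
`RoyThesisTyped.schanuelRank_anti`). So `RoyThesisTyped ⇐ SchanuelTwo ∧ RankStep` is the split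
`A ∧ (A → X)`: its second child is the bare complement of the first. [folklore] -/
theorem RoyThesisTyped.rankStep_iff_complement :
    (∀ l : ℕ, 2 ≤ l → SchanuelRank l → SchanuelRank (l + 1)) ↔ (SchanuelTwo → RoyThesisTyped) := by
  constructor
  · exact fun hs h2 => RoyThesisTyped.of_schanuelTwo_of_rankStep h2 hs
  · intro h l hl hSl
    have h2 : SchanuelTwo :=
      schanuelTwo_iff_schanuelRank_two.mpr (RoyThesisTyped.schanuelRank_anti hl hSl)
    exact (Roy2001_iff_holds (l + 1)).mp (h h2 (l + 1))

/-! ## §3 The split by Diophantine regime is genuine but toothless -/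

/-- **Regime split** (glue = excluded middle through the pointwise form of the crux
`RoyThesisTyped.crux_iff_pointwise`): for every predicate `P` on tuples the crux is the conjunction of
Schanuel's inequality on the `ℚ`-free tuples satisfying `P` and on those satisfying `¬P`. [folklore] -/
theorem RoyThesisTyped.crux_iff_regimes (P : ∀ {l : ℕ}, (Fin l → ℂ) → Prop) :
    RoyThesisTyped ↔
      (∀ (l : ℕ) (y : Fin l → ℂ), LinearIndependent ℚ y → P y →
        (l : Cardinal) ≤ Algebra.trdeg ℚ
          ↥(IntermediateField.adjoin ℚ (Set.range y ∪ Set.range (cexp ∘ y)))) ∧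
      (∀ (l : ℕ) (y : Fin l → ℂ), LinearIndependent ℚ y → ¬ P y →
        (l : Cardinal) ≤ Algebra.trdeg ℚ
          ↥(IntermediateField.adjoin ℚ (Set.range y ∪ Set.range (cexp ∘ y)))) := by
  rw [RoyThesisTyped.crux_iff_pointwise]
  constructor
  · exact fun h => ⟨fun l y hy _ => h l y hy, fun l y hy _ => h l y hy⟩
  · rintro ⟨hP, hnP⟩ l y hy
    by_cases hPy : P y
    · exact hP l y hy hPy
    · exact hnP l y hy hPy

/-- A non-zero integer linear form in `1, πi` has norm `≥ 1` (real part `h₀`, imaginary part `h₁π`).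
[folklore] -/
theorem RoyThesisTyped.one_le_norm_intForm_one_piI (h : Fin 2 → ℤ) (hh : h ≠ 0) :
    (1 : ℝ) ≤ ‖∑ i, (h i : ℂ) * (![(1 : ℂ), (Real.pi : ℂ) * I] i)‖ := by
  have hsum : ∑ i, (h i : ℂ) * (![(1 : ℂ), (Real.pi : ℂ) * I] i) =
      (h 0 : ℂ) + (h 1 : ℂ) * ((Real.pi : ℂ) * I) := by
    simp [Fin.sum_univ_two]
  rw [hsum]
  set z : ℂ := (h 0 : ℂ) + (h 1 : ℂ) * ((Real.pi : ℂ) * I) with hz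
  have hre : z.re = (h 0 : ℝ) := by simp [hz]
  have him : z.im = (h 1 : ℝ) * Real.pi := by simp [hz]
  by_cases h1 : h 1 = 0
  · have h0 : h 0 ≠ 0 := by
      intro h0
      apply hh
      ext i; fin_cases i <;> simp [h0, h1]
    have h0' : (1 : ℝ) ≤ |(h 0 : ℝ)| := by
      have : (1 : ℤ) ≤ |h 0| := Int.one_le_abs h0
      exact_mod_cast this
    calc (1 : ℝ) ≤ |(h 0 : ℝ)| := h0'
      _ = |z.re| := by rw [hre]
      _ ≤ ‖z‖ := Complex.abs_re_le_norm z
  · have h1' : (1 : ℝ) ≤ |(h 1 : ℝ)| := by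
      have : (1 : ℤ) ≤ |h 1| := Int.one_le_abs h1
      exact_mod_cast this
    have hpi : (1 : ℝ) ≤ Real.pi := le_of_lt (lt_of_lt_of_le (by norm_num) Real.two_le_pi)
    calc (1 : ℝ) = 1 * 1 := by ring
      _ ≤ |(h 1 : ℝ)| * Real.pi := mul_le_mul h1' hpi zero_le_one (abs_nonneg _)
      _ = |(h 1 : ℝ) * Real.pi| := by
          rw [abs_mul, abs_of_pos Real.pi_pos]
      _ = |z.im| := by rw [him]
      _ ≤ ‖z‖ := Complex.abs_im_le_norm z

/-- **The Technical Hypothesis holds at `(1, πi)`** (every non-zero integer form in `1, πi` has norm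
`≥ 1 ≥ exp(−H^ε)`). [cite: NesterenkoPhilippon2001, Ch. 14 Definition 2.6] -/
theorem RoyThesisTyped.technicalHypothesis_one_piI :
    Literature.Barriers.Schanuel.TechnicalHypothesis ![(1 : ℂ), (Real.pi : ℂ) * I] := by
  intro ε hε
  refine ⟨1, one_pos, fun H hH h hh _ => ?_⟩
  have hexp : Real.exp (-(H ^ ε)) ≤ 1 := by
    rw [Real.exp_le_one_iff, neg_nonpos]
    exact Real.rpow_nonneg (le_trans zero_le_one hH) ε
  exact hexp.trans (RoyThesisTyped.one_le_norm_intForm_one_piI h hh)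

/-- **The T.H.-half of the regime split still implies `e ⊥ π`**: Schanuel's inequality on the `ℚ`-free
tuples satisfying the Technical Hypothesis, applied at `(1, πi)` (`ℚ`-free:
`Literature.Barriers.Schanuel.linearIndependent_one_piI`; T.H.: `technicalHypothesis_one_piI`), gives
`2 ≤ trdeg ℚ(1, πi, e, e^{πi})`, hence the algebraic independence of `e` and `π`
(`expOnePiAlgebraicIndependent_of_two_le_trdeg`). So the regime split isolates nothing provable: its
"generic" half has Schanuel-rank-2 strength. [cite: BakerTNT1975, Ch. 12 p. 120] -/
theorem RoyThesisTyped.expOnePi_of_crux_on_technicalHypothesis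
    (h : ∀ (l : ℕ) (y : Fin l → ℂ), LinearIndependent ℚ y →
      Literature.Barriers.Schanuel.TechnicalHypothesis y →
        (l : Cardinal) ≤ Algebra.trdeg ℚ
          ↥(IntermediateField.adjoin ℚ (Set.range y ∪ Set.range (cexp ∘ y)))) :
    ExpOnePiAlgebraicIndependent :=
  expOnePiAlgebraicIndependent_of_two_le_trdeg
    (h 2 _ Literature.Barriers.Schanuel.linearIndependent_one_piI
      RoyThesisTyped.technicalHypothesis_one_piI)

/-! ## §4 The strengthening "conclusion `l + 1`" is false (typed crux) -/

/-- **`l + 1` in place of `l` is false** for the typed crux: `(y, α) = (1, e)` is `ℚ`-free with units,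
satisfies Roy's hypothesis in the admissible window `(1.3, 0.7, 1.2, 0.5, 1.32)` (`royHypothesis_exp'`),
and `trdeg ℚ(1, e) ≤ 1 < 2` (`RoyThesisNegative`-style witness, restated here def-free for the typed
decl). [folklore] -/
theorem RoyThesisTyped.not_succ_conclusion :
    ¬ (∀ (n : ℕ) (y α : Fin n → ℂ), LinearIndependent ℚ y → (∀ j, α j ≠ 0) →
      ∀ (s₀ s₁ t₀ t₁ u : ℝ), RoyAdmissible s₀ s₁ t₀ t₁ u → RoyHypothesis y α s₀ s₁ t₀ t₁ u →
        ((n + 1 : ℕ) : Cardinal) ≤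
          Algebra.trdeg ℚ ↥(IntermediateField.adjoin ℚ (Set.range y ∪ Set.range α))) := by
  intro h
  have hli : LinearIndependent ℚ (![(1 : ℂ)] : Fin 1 → ℂ) := by
    rw [Fintype.linearIndependent_iff]
    intro g hg i
    fin_cases i
    simpa [Fin.sum_univ_one, Rat.smul_def] using hg
  have hhyp := royHypothesis_exp' (![(1 : ℂ)] : Fin 1 → ℂ) royAdmissible_example
  have h2 := h 1 ![1] (cexp ∘ ![1]) hli (fun j => Complex.exp_ne_zero _)
    _ _ _ _ _ royAdmissible_example hhyp
  -- `ℚ(1, e) ⊆ ℚ(e)`, of transcendence degree ≤ 1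
  have hle : IntermediateField.adjoin ℚ (Set.range (![(1 : ℂ)] : Fin 1 → ℂ) ∪ Set.range (cexp ∘ ![1])) ≤
      IntermediateField.adjoin ℚ ({cexp 1} : Set ℂ) := by
    rw [IntermediateField.adjoin_le_iff]
    rintro x (⟨j, rfl⟩ | ⟨j, rfl⟩)
    · have : (![(1 : ℂ)] j) = 1 := by fin_cases j; rfl
      rw [this]; exact one_mem _
    · have : (cexp ∘ ![(1 : ℂ)]) j = cexp 1 := by fin_cases j; rfl
      rw [this]; exact IntermediateField.mem_adjoin_simple_self ℚ _
  have h1 : Algebra.trdeg ℚ ↥(IntermediateField.adjoin ℚ ({cexp 1} : Set ℂ)) ≤ 1 :=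
    Literature.Barriers.Schanuel.trdeg_adjoin_singleton_le_one (K := ℚ) (cexp 1)
  have := (h2.trans (trdeg_le_of_injective (IntermediateField.inclusion hle)
    (IntermediateField.inclusion_injective hle))).trans h1
  norm_num at this

end Summit.Schanuel.Schanuel.Theorems

end
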